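import Mathlib
import Summits.Ventures.PercRepro2.HCov
import Summits.Ventures.PercRepro2.RECMReduction
import Summits.Ventures.PercRepro2.CutVertexPaths
import Summits.Ventures.PercRepro2.GcSkelRules
import Summits.Ventures.PercRepro2.GcSkelReduction
import Summits.Ventures.PercRepro2.GcSkelReductionI
import Summits.Ventures.PercRepro2.GcSkelCutShape
import Summits.Ventures.PercRepro2.GcSkelCutShapeMain

/-!
# The crux as (G1) + the two-connected cores (blind cell PercRepro2, typer-1 g53)

The weighted residual `WRed.WReducedI` splits along the non-loop degree of `a₃`:

* **`HCovG1_all`** — (HCOV) on the residual instances with `a₃` a leaf (S3.10's (G1): by the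
  clauses of the residual the leaf hangs at an unmarked vertex of non-loop degree `≥ 3`, and by
  `cutVertex_shape_of_wredI` this is the only cut-vertex configuration of the residual);
* **`HCovCore_all`** — (HCOV) on the residual instances with `a₃` not a leaf: by
  `no_cutVertex_of_wredI_of_a3_not_leaf` these have no cut vertex with a non-loop edge on each
  side — THE TWO-CONNECTED CORES.

**`HCov_all_iff_G1_and_Core`**: (HCOV) for every finite weighted graph with five distinct marks
is exactly (G1) together with the cores — the crux of record in two named pieces.
-/

namespace Summit.Ventures.PercRepro2

open CovForm RECM CutVertexM9

namespace WRed

section Closures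

variable (R : Type*) [Field R] [LinearOrder R] [IsStrictOrderedRing R]

/-- **(G1)**: (HCOV) on the residual instances in which `a₃` is a leaf. -/
def HCovG1_all : Prop :=
  ∀ (V E : Type) [Fintype V] [DecidableEq V] [Fintype E] [DecidableEq E]
    (ends : E → Sym2 V) (p : E → R), IsProbVec p →
    ∀ o a₁ a₂ a₃ b : V, a₁ ≠ a₂ → a₁ ≠ a₃ → a₂ ≠ a₃ → o ≠ a₁ → o ≠ a₂ → o ≠ a₃ → o ≠ b →
      b ≠ a₁ → b ≠ a₂ → b ≠ a₃ → WReducedI ends o a₁ a₂ a₃ b → nonLoopDeg ends a₃ = 1 →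
      HCov p ends o a₁ a₂ a₃ b

/-- **The cores**: (HCOV) on the residual instances in which `a₃` is not a leaf. -/
def HCovCore_all : Prop :=
  ∀ (V E : Type) [Fintype V] [DecidableEq V] [Fintype E] [DecidableEq E]
    (ends : E → Sym2 V) (p : E → R), IsProbVec p →
    ∀ o a₁ a₂ a₃ b : V, a₁ ≠ a₂ → a₁ ≠ a₃ → a₂ ≠ a₃ → o ≠ a₁ → o ≠ a₂ → o ≠ a₃ → o ≠ b →
      b ≠ a₁ → b ≠ a₂ → b ≠ a₃ → WReducedI ends o a₁ a₂ a₃ b → nonLoopDeg ends a₃ ≠ 1 →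
      HCov p ends o a₁ a₂ a₃ b

end Closures

section Main

variable {R : Type*} [Field R] [LinearOrder R] [IsStrictOrderedRing R]

omit [IsStrictOrderedRing R] in
/-- The residual's closure is (G1) together with the cores. -/
theorem HCovWRedI_all_iff_G1_and_Core : HCovWRedI_all R ↔ HCovG1_all R ∧ HCovCore_all R := by
  constructor
  · intro h
    exact ⟨fun V E _ _ _ _ ends p hp o a₁ a₂ a₃ b h12 h13 h23 ho1 ho2 ho3 hob hb1 hb2 hb3 hred _ =>
        h V E ends p hp o a₁ a₂ a₃ b h12 h13 h23 ho1 ho2 ho3 hob hb1 hb2 hb3 hred,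
      fun V E _ _ _ _ ends p hp o a₁ a₂ a₃ b h12 h13 h23 ho1 ho2 ho3 hob hb1 hb2 hb3 hred _ =>
        h V E ends p hp o a₁ a₂ a₃ b h12 h13 h23 ho1 ho2 ho3 hob hb1 hb2 hb3 hred⟩
  · rintro ⟨hG, hC⟩ V E _ _ _ _ ends p hp o a₁ a₂ a₃ b h12 h13 h23 ho1 ho2 ho3 hob hb1 hb2 hb3 hred
    by_cases hd : nonLoopDeg ends a₃ = 1
    · exact hG V E ends p hp o a₁ a₂ a₃ b h12 h13 h23 ho1 ho2 ho3 hob hb1 hb2 hb3 hred hd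
    · exact hC V E ends p hp o a₁ a₂ a₃ b h12 h13 h23 ho1 ho2 ho3 hob hb1 hb2 hb3 hred hd

/-- **THE CRUX IN TWO NAMED PIECES**: (HCOV) for every finite weighted graph with five distinct
marks is exactly (G1) — `a₃` a leaf at an unmarked vertex of degree `≥ 3` on the residual —
together with (HCOV) on the two-connected cores. -/
theorem HCov_all_iff_G1_and_Core : HCov_all R ↔ HCovG1_all R ∧ HCovCore_all R :=
  HCov_all_iff_HCovWRedI_all.trans HCovWRedI_all_iff_G1_and_Core

/-- On the cores no cut vertex has a non-loop edge on each side: the instances of `HCovCore_all`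
are two-connected on their edge-carrying part. -/
theorem core_no_cutVertex {V E : Type*} [Fintype E] [DecidableEq V] {ends : E → Sym2 V}
    {o a₁ a₂ a₃ b : V} (h : WReducedI ends o a₁ a₂ a₃ b) (hd3 : nonLoopDeg ends a₃ ≠ 1)
    (h12 : a₁ ≠ a₂) (h13 : a₁ ≠ a₃) (h23 : a₂ ≠ a₃) (ho1 : o ≠ a₁) (ho2 : o ≠ a₂) (ho3 : o ≠ a₃)
    (hob : o ≠ b) (hb1 : b ≠ a₁) (hb2 : b ≠ a₂) (hb3 : b ≠ a₃) :
    ¬ ∃ (side : E → Bool) (L : Set V) (v : V) (Rt : Set V), CutVertex ends side L v Rt ∧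
      (∃ g, side g = true ∧ ¬ (ends g).IsDiag) ∧ (∃ g, side g = false ∧ ¬ (ends g).IsDiag) := by
  rintro ⟨side, L, v, Rt, hcut, hL, hR⟩
  exact no_cutVertex_of_wredI_of_a3_not_leaf h hd3 hcut hL hR h12 h13 h23 ho1 ho2 ho3 hob hb1 hb2
    hb3

/-- On (G1) the leaf `a₃` hangs at an unmarked vertex of non-loop degree `≥ 3`. -/
theorem g1_leaf_shape {V E : Type*} [Fintype E] [DecidableEq V] {ends : E → Sym2 V}
    {o a₁ a₂ a₃ b : V} (h : WReducedI ends o a₁ a₂ a₃ b) (hd3 : nonLoopDeg ends a₃ = 1) :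
    ∃ (e : E) (x : V), ends e = s(x, a₃) ∧ x ≠ a₃ ∧ Unmarked o a₁ a₂ a₃ b x ∧
      3 ≤ nonLoopDeg ends x ∧ ∀ g, g ≠ e → a₃ ∈ ends g → (ends g).IsDiag := by
  obtain ⟨e, x, he, hx, hleaf⟩ := leaf_of_nonLoopDeg_one hd3
  have hux : Unmarked o a₁ a₂ a₃ b x := h.leaf_a3 e x he hx hd3
  refine ⟨e, x, he, hx, hux, ?_, hleaf⟩
  have hed : ¬ (ends e).IsDiag := by
    rw [he, Sym2.mk_isDiag_iff]
    exact hx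
  have hpos : 0 < nonLoopDeg ends x :=
    Finset.card_pos.mpr ⟨e, mem_edgesAt.mpr ⟨by rw [he]; exact Sym2.mem_mk_left _ _, hed⟩⟩
  obtain ⟨h1, h2⟩ := h.unmarked x hux
  omega

end Main

end WRed

end Summit.Ventures.PercRepro2
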